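import Summits.QuantumFields.YangMills.Theorems.UnitScaleTiltProp7SkewSplitFrobeniusRow
import Summits.QuantumFields.YangMills.Theorems.UnitScaleTiltProp7SlotRowOfDeltaEta
import HarnessLib

/-!
# Route `UnitScaleTilt`, crux «MinimiserStabilityRegPr» (stmt-QuantumFields-19200, stub EX), positivity block, pen (b1) glue — RIDER DOOR OVER ✓`Prop7SkewSplitFrobeniusRow`
# (w7-19200 g10 FILE 4): **THE REAL-STRUCTURE EXTENSION IN THE OPERATOR-NORM CURRENCY OF THE TUBE-COMPARISON ROW** — a row `Σ|T X|² ≤ α·Σ|Q X|² + β·Σ|X|²` in the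
# `L²`-operator norm `|·|` of `M₂(ℂ)` proved on ANTI-HERMITIAN carriers holds on ALL carriers with `α ↦ 4α`, `β ↦ 4β` (EX namer w2 g11, 2026-08-29; w7 g10 de-twin word
# 20:49:53Z «YES to the non-twin §4 as a rider door over FILE 4»; LOCATE-QCMP-B1-w7g10 §5 «constants ×2 on α and β … 32 becomes 64»)

Cell `ym3-torus` (HUMAN RULING D-0037: YM₃ on T³ is ladder rung R3 — NOT d = 4, NOT infinite volume, NOT a mass gap, NOT Clay).  Width seat `ym-ust-19200-w2` (gen 11).
THEOREMS ONLY (0 `def`, 0 `sorry`); `--supports stmt-QuantumFields-19200 --as helper`, count-neutral.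

THE POINT.  ✓`Prop7SkewSplitFrobeniusRow.row_of_skew_row` is the extension lemma in FROBENIUS currency (`‖frobEquiv⁻¹ ·‖²`, no loss).  The displayed row `hQcmp` of
✓`Prop7TransverseRowOfQTwSTubeComparison` (p740688) ∕ ✓`Prop7TransverseRowOfTubeRowRegPr` (p743306) and the (T) engine speak the OPERATOR norm `|·|` on `M₂(ℂ)`
(`open scoped Matrix.Norms.L2Operator`).  On `M₂(ℂ)`: `|X|² ≤ ‖frobEquiv⁻¹X‖² ≤ 2|X|²` (✓`Prop7RieszTauFrobNorm.norm_le_norm_frobEquiv_symm`, ✓`Prop7SlotRowOfDeltaEta.norm_sq_frobEquiv_symm_le`,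
BY NAME — no restatement), so an op-norm row on anti-Hermitian carriers gives a Frobenius row with constants `2α, 2β`, which extends by FILE 4, and converts back with another
factor `2`: `4α, 4β`.

WHAT IS PROVED (ns `…Theorems.Prop7SkewSplitOpNormRow`).
* §1 the summed conversions `sum_opNorm_sq_le_sum_frob` (`Σ_k |Y k|² ≤ Σ_k ‖frobEquiv⁻¹(Y k)‖²`), `sum_frob_le_two_mul_sum_opNorm_sq` (`Σ_k ‖frobEquiv⁻¹(Y k)‖² ≤ 2·Σ_k |Y k|²`).
* §2 ★★ `opRow_of_skewOpRow` — for star-compatible ℂ-linear `T : (β → M₂(ℂ)) →ₗ[ℂ] (γ → M₂(ℂ))`, `Q : (β → M₂(ℂ)) →ₗ[ℂ] (δ → M₂(ℂ))` (FILE 4's hypotheses `hT`, `hQ` verbatim) and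
  `0 ≤ α, β`: `(∀ A anti-Hermitian, Σ_c |T A c|² ≤ α·Σ_d |Q A d|² + β·Σ_b |A b|²) → ∀ X, Σ_c |T X c|² ≤ 4α·Σ_d |Q X d|² + 4β·Σ_b |X b|²`.
HONEST SCOPE.  Finite-dimensional linear algebra; nothing of (b1), `hQcmp`, (T), the γ-row, a print row, EX or the crux is proved or claimed; the star-compatibility of the concrete
operators `T^{str}_{U₀}` ∕ `QTwS U₀` is the (b1) pen's to check; nothing continuum ∕ OS ∕ mass-gap ∕ Clay.

References: T. Bałaban, CMP **98** (1985) 17–51 [Balaban1985Averaging] ((18)–(20) pp.20–21: `‖X‖ ≤ |X| ≤ √N‖X‖` between the two matrix norms); CMP **99** (1985) 389–434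
[Balaban1985BackgroundPropagators] ((3.14)–(3.15) p.393, Thm 3.11 p.416).
-/

set_option autoImplicit false

noncomputable section

open scoped BigOperators ComplexConjugate InnerProductSpace Matrix Matrix.Norms.L2Operator

namespace Summit.QuantumFields.YangMills.Theorems.Prop7SkewSplitOpNormRow

open Summit.QuantumFields.YangMills.Theorems.Prop7SectET3HilbertLetters (W₂ frobEquiv frobEquiv_symm_apply_apply)
open Summit.QuantumFields.YangMills.Theorems.Prop7SkewSplitFrobeniusRow (row_of_skew_row)
open Summit.QuantumFields.YangMills.Theorems.Prop7RieszTauFrobNorm (norm_le_norm_frobEquiv_symm)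
open Summit.QuantumFields.YangMills.Theorems.Prop7SlotRowOfDeltaEta (norm_sq_frobEquiv_symm_le)

/-! ## §1 The two normings of `M₂(ℂ)`, summed: `Σ|Y k|² ≤ Σ‖frobEquiv⁻¹(Y k)‖² ≤ 2Σ|Y k|²` (✓`norm_le_norm_frobEquiv_symm`, ✓`norm_sq_frobEquiv_symm_le` by name) -/

/-- Summed: `Σ_k |Y k|² ≤ Σ_k ‖frobEquiv⁻¹(Y k)‖²`. [cite: Balaban1985Averaging, (20) p.21] -/
theorem sum_opNorm_sq_le_sum_frob {κ : Type*} [Fintype κ] (Y : κ → Matrix (Fin 2) (Fin 2) ℂ) :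
    ∑ k, ‖Y k‖ ^ 2 ≤ ∑ k, ‖(frobEquiv.symm (Y k) : W₂)‖ ^ 2 :=
  Finset.sum_le_sum fun k _ => pow_le_pow_left₀ (norm_nonneg _) (norm_le_norm_frobEquiv_symm (Y k)) 2

/-- Summed: `Σ_k ‖frobEquiv⁻¹(Y k)‖² ≤ 2·Σ_k |Y k|²`. [cite: Balaban1985Averaging, (20) p.21] -/
theorem sum_frob_le_two_mul_sum_opNorm_sq {κ : Type*} [Fintype κ] (Y : κ → Matrix (Fin 2) (Fin 2) ℂ) :
    ∑ k, ‖(frobEquiv.symm (Y k) : W₂)‖ ^ 2 ≤ 2 * ∑ k, ‖Y k‖ ^ 2 := by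
  rw [Finset.mul_sum]
  exact Finset.sum_le_sum fun k _ => norm_sq_frobEquiv_symm_le (Y k)

/-! ## §2 ★★ The extension lemma in operator-norm currency -/

/-- ★★ **A COMPARISON ROW IN OPERATOR NORM ON ANTI-HERMITIAN CARRIERS HOLDS ON ALL CARRIERS WITH CONSTANTS ×4.**  For star-compatible ℂ-linear `T`, `Q` (the hypotheses of
✓`Prop7SkewSplitFrobeniusRow.row_of_skew_row` verbatim) and `0 ≤ α, β`: `(∀ A, (∀ b, (A b)ᴴ = −A b) → Σ_c |T A c|² ≤ α·Σ_d |Q A d|² + β·Σ_b |A b|²) → ∀ X,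
Σ_c |T X c|² ≤ 4α·Σ_d |Q X d|² + 4β·Σ_b |X b|²` — via §1 and FILE 4 at constants `2α`, `2β`.
[cite: Balaban1985Averaging, (18)–(20) p.21; Balaban1985BackgroundPropagators, (3.14)–(3.15) p.393] -/
theorem opRow_of_skewOpRow {β γ δ : Type*} [Fintype β] [Fintype γ] [Fintype δ]
    (T : (β → Matrix (Fin 2) (Fin 2) ℂ) →ₗ[ℂ] (γ → Matrix (Fin 2) (Fin 2) ℂ))
    (Q : (β → Matrix (Fin 2) (Fin 2) ℂ) →ₗ[ℂ] (δ → Matrix (Fin 2) (Fin 2) ℂ))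
    (hT : ∀ (X : β → Matrix (Fin 2) (Fin 2) ℂ) (c : γ), T (fun b => (X b)ᴴ) c = (T X c)ᴴ)
    (hQ : ∀ (X : β → Matrix (Fin 2) (Fin 2) ℂ) (d : δ), Q (fun b => (X b)ᴴ) d = (Q X d)ᴴ)
    {α βc : ℝ} (hα : 0 ≤ α) (hβ : 0 ≤ βc)
    (hrow : ∀ A : β → Matrix (Fin 2) (Fin 2) ℂ, (∀ b, (A b)ᴴ = -A b) →
      ∑ c, ‖T A c‖ ^ 2 ≤ α * ∑ d, ‖Q A d‖ ^ 2 + βc * ∑ b, ‖A b‖ ^ 2)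
    (X : β → Matrix (Fin 2) (Fin 2) ℂ) :
    ∑ c, ‖T X c‖ ^ 2 ≤ 4 * α * ∑ d, ‖Q X d‖ ^ 2 + 4 * βc * ∑ b, ‖X b‖ ^ 2 := by
  -- the anti-Hermitian row in Frobenius currency with constants `2α`, `2β`
  have hF : ∀ A : β → Matrix (Fin 2) (Fin 2) ℂ, (∀ b, (A b)ᴴ = -A b) →
      ∑ c, ‖(frobEquiv.symm (T A c) : W₂)‖ ^ 2
        ≤ (2 * α) * ∑ d, ‖(frobEquiv.symm (Q A d) : W₂)‖ ^ 2 + (2 * βc) * ∑ b, ‖(frobEquiv.symm (A b) : W₂)‖ ^ 2 := by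
    intro A hA
    have h := hrow A hA
    have hT2 := sum_frob_le_two_mul_sum_opNorm_sq (T A)
    have hQ1 := sum_opNorm_sq_le_sum_frob (Q A)
    have hA1 := sum_opNorm_sq_le_sum_frob A
    nlinarith [mul_le_mul_of_nonneg_left hQ1 hα, mul_le_mul_of_nonneg_left hA1 hβ]
  -- FILE 4 extends it to every carrier; convert back
  have hG := row_of_skew_row T Q hT hQ (2 * α) (2 * βc) hF X
  have hT1 := sum_opNorm_sq_le_sum_frob (T X)
  have hQ2 := sum_frob_le_two_mul_sum_opNorm_sq (Q X)
  have hX2 := sum_frob_le_two_mul_sum_opNorm_sq X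
  nlinarith [mul_le_mul_of_nonneg_left hQ2 hα, mul_le_mul_of_nonneg_left hX2 hβ]

end Summit.QuantumFields.YangMills.Theorems.Prop7SkewSplitOpNormRow

end
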